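import Literature.NumberTheory.EllipticCurves.PAdicLFunctionTameIntegralityAtTwoProofs
import Literature.NumberTheory.EllipticCurves.PAdicLFunctionMinusIntegralityProofs
import HarnessLib

/-!
# INT2-AUTO at the cusps over the primes of the level: `‖μ_{f,α,m}‖₂ ≤ 2`, `L₂(f,α,χ) ∈ Λ` and
# `L₂(f,α,χ) ≡ L₂(f,α,𝟙_m) (mod 2Λ)` for a tame level `m` SHARING primes with `N` that divide `N` once
# (Manin's trick at the cusp `1/g`; Matsuno 2000, Lemma 3.2 at `p = 2`; PROOFS ONLY)

A *proofs* file (theorems only: no definition, no named fact, no axiom). The tree's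
`PAdicLFunctionTameCongruenceAtTwoAutoProofs` proves the `2`-integrality of the tame Mazur–Swinnerton-Dyer
transforms `L₂(f, α, χ, T)` (`padicLFunctionTame`) and Matsuno's congruence `L₂(f,α,χ) ≡ L₂(f,α,𝟙_m) (mod 2Λ)`
for the newform `f` (level `N`) of a curve good ordinary at `2` under the hypothesis `(m, N) = 1`: every tame
fraction `x = c/(2ⁿm)` then has denominator prime to `N`, so the cusp `x` is `Γ₀(N)`-equivalent to `0` and
`[x]⁺_f = [0]⁺_f + k/2` (`exists_ratPlusSymbol_eq_add_div_two`). This file removes the coprimality at the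
primes dividing `N` EXACTLY ONCE (the multiplicative primes of the curve), i.e. it works under

  `hmN : ∀ ℓ, ℓ.Prime → ℓ ∣ m → ¬ ℓ ^ 2 ∣ N`   («`N` is square-free at the primes of `m`»).

THE ARGUMENT (Manin 1972 / Cremona 1997 §2.2 cusp equivalence on `X₀(N)`, Manin's trick, one Hecke relation):
1. (the tree's `modularSymbol_div_sub_inv_mem_periodLattice`, `PAdicLFunctionMinusIntegralityProofs` §2) a cusp
   `u/v` with `g ∣ v`, `g ∣ N`, `gcd(u, v) = 1` and `gcd(v, N/g) = 1` is `Γ₀(N)`-equivalent to `1/g` (an explicit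
   `γ ∈ Γ₀(N)` with `γ(1/g) = u/v`, so `{∞, u/v} − {∞, 1/g} = {∞, γ∞} ∈ Λ_f`); for `x ∈ ℚ` this reads (`modularSymbol_sub_inv_gcd_mem_periodLattice`): with `g = gcd(den x, N)`,
   `gcd(den x, N/g) = 1 ⟹ {∞, x} ≡ {∞, 1/g} (mod Λ_f)` (the class of a cusp of `X₀(N)` whose denominator meets
   `N` in `g` with `gcd(g, N/g) = 1` is determined by `g`);
2. (`sub_mul_modularSymbol_inv_mem_periodLattice`) the Eisenstein multiple AT `1/g`: for a prime `q ∤ N`,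
   `(a_q − q − 1){∞, 1/g} ∈ Λ_f`, because the `q + 1` cusps `(1/g + j)/q = (1 + jg)/(qg)`, `q/g` of the Hecke
   relation `a_q{∞, 1/g} = ∑_j {∞, (1/g + j)/q} + {∞, q/g}` (`cuspCoeff_mul_modularSymbol`) all lie in the class
   of `1/g` (step 1);
3. (`exists_sub_three_mul_ratPlusSymbol_inv_eq_div_two`) at `q = 2 ∤ N`: **`(a₂ − 3)[1/g]⁺_f ∈ ½ℤ`** — the
   Eisenstein multiple at `2`, available WITHOUT any hypothesis on `E[2]`, now at every cusp `1/g`;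
4. (`norm_msdMeasureTame_two_le_two_sqfreeAt`) for the tame fractions `x = c/(2ⁿm)` and `2x` one has
   `gcd(den, N) = g` (the same `g`, `N` odd) and `gcd(den, N/g) = 1` (by `hmN`), so
   `μ_{f,α,m}((a + 2ⁿℤ₂) × {b}) = α⁻ⁿ[x]⁺ − α⁻ⁿ⁻¹[2x]⁺ = α⁻ⁿk₁/2 − α⁻ⁿ⁻¹k₂/2 + α⁻ⁿ⁻¹(α − 1)[1/g]⁺` with
   `‖(α − 1)[1/g]⁺‖₂ ≤ 2` (`(α − 1)(α − 2) = (a₂ − 3)α`, `‖α‖₂ = ‖α − 2‖₂ = 1`): `‖μ_{f,α,m}‖₂ ≤ 2`;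
5. (§5) the tree's chain verbatim on that bound: `norm_padicLCoeffTame_two_le_one_sqfreeAt`,
   `exists_iwasawaToPowerSeries_eq_padicLFunctionTame_two_sqfreeAt` (`L₂(f,α,χ) ∈ Λ`, `χ` even),
   `norm_padicLCoeffTame_sub_one_two_le_sqfreeAt` (Matsuno L.3.2 at `2`), `exists_iwasawa_pair_map_toZMod_eq_two_sqfreeAt`.

MOTIVATION (cell bsd-2adic, seat conv-1 GEN 16, route S3 `TwoAdicConverse`): the analytic Kida formula at `2` along a
quadratic twist `E ↦ E^{(d)}` by `d > 0`, `d ≡ 1 (mod 4)` is in the tree for `(d, N_E) = 1`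
(`PAdicLFunctionQuadraticTwistCongruenceAtTwoProofs`); dropping the coprimality at the MULTIPLICATIVE primes of `E`
needs the tame machinery at a level `m = d` meeting `N_E` at primes `ℓ ∥ N_E` — this file is its integrality leg.
The algebraic leg (Matsuno 2008 Thm. 4.2 along a twist, `matsuno2008_thm42_transport_two_twist`) has no coprimality
clause. Normalisation caveats as in `PAdicLFunctionIntegralityAtTwoAutoProofs` (tree's `Δ`-doubled transform,
periods `Ω⁺_f`). STATUS IN PRINT: elementary (cusp classes of `Γ₀(N)`: Manin 1972 Prop. 1.4 / Cremona §2.2;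
Manin's trick: Cremona §2.8 (2.8.8); Matsuno 2000 states Lemma 3.2 for his lattice `𝓛_E` at any tame level).

## References

* Ju. I. Manin, *Parabolic points and zeta functions of modular curves*, Izv. Akad. Nauk SSSR 36 (1972),
  Prop. 1.4, Thm. 1.6, §3. [Manin1972]
* J. E. Cremona, *Algorithms for modular elliptic curves*, 2nd ed. (1997), §2.2 (cusp equivalence), §2.8 (2.8.8).
  [CremonaAlgorithms1997]
* B. Mazur, J. Tate, J. Teitelbaum, Invent. Math. 84 (1986), §I.4 (4.2), §I.8, §I.10 (10.1), §I.12–I.13.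
  [MazurTateTeitelbaum1986Invent]
* K. Matsuno, J. Number Theory 84 (2000) 80–92, Lemma 3.2 (p. 87). [Matsuno2000]
-/

noncomputable section

open scoped Classical MatrixGroups ModularForm

open CongruenceSubgroup Filter Topology Literature.NumberTheory.EllipticCurves.ModularForms

namespace Literature.NumberTheory.EllipticCurves.ModularForms

/-! ### §1. Cusps whose denominator meets `N` in `g`, `gcd(g, N/g) = 1`, are equivalent to `1/g` -/

section CuspClass

variable {N : ℕ} [NeZero N] (f : CuspForm (Gamma0 N) 2)

/-- **A cusp `x` with `gcd(den x, N/g) = 1`, `g = gcd(den x, N)`, is `Γ₀(N)`-equivalent to `1/g`**: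
`{∞, x}_f − {∞, 1/g}_f ∈ Λ_f` (write `x = u/v` in lowest terms: `g ∣ v`, `gcd(v, N/g) = 1`, and apply the tree's explicit
`Γ₀(N)`-matrix `modularSymbol_div_sub_inv_mem_periodLattice` of `PAdicLFunctionMinusIntegralityProofs`, Cremona's
Lemma 2.2.3 (3)). For `(den x, N) = 1` (`g = 1`) this is the class of `1 ∼ 0`
(`modularSymbol_sub_zero_mem_periodLattice`). [cite: Manin1972, Prop. 1.4 and Thm. 1.6]
[cite: CremonaAlgorithms1997, §2.2] -/
theorem modularSymbol_sub_inv_gcd_mem_periodLattice {x : ℚ} (hx : Nat.Coprime x.den (N / Nat.gcd x.den N)) :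
    modularSymbol f x - modularSymbol f (1 / ((Nat.gcd x.den N : ℕ) : ℚ)) ∈ periodLattice f := by
  set g : ℕ := Nat.gcd x.den N with hgdef
  have hg : g ∣ N := Nat.gcd_dvd_right _ _
  have hN : (N : ℤ) = (g : ℤ) * ((N / g : ℕ) : ℤ) := by exact_mod_cast (Nat.mul_div_cancel' hg).symm
  have hc : (x.den : ℤ) = (g : ℤ) * ((x.den / g : ℕ) : ℤ) := by
    exact_mod_cast (Nat.mul_div_cancel' (Nat.gcd_dvd_left x.den N)).symm
  have hv : (x.den : ℤ) ≠ 0 := by exact_mod_cast x.den_ne_zero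
  have h1 : IsCoprime x.num (x.den : ℤ) := by
    rw [Int.isCoprime_iff_gcd_eq_one, Int.gcd, Int.natAbs_natCast]
    exact x.reduced
  have h2 : IsCoprime (x.den : ℤ) ((N / g : ℕ) : ℤ) := Nat.isCoprime_iff_coprime.mpr hx
  have h := modularSymbol_div_sub_inv_mem_periodLattice f hN hc hv h1 h2
  have hx' : ((x.num : ℤ) : ℚ) / ((x.den : ℕ) : ℚ) = x := Rat.num_div_den x
  have hx'' : ((x.num : ℤ) : ℚ) / (((x.den : ℕ) : ℤ) : ℚ) = x := by push_cast; exact hx'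
  rw [hx''] at h
  have hgq : (((g : ℕ) : ℤ) : ℚ) = ((g : ℕ) : ℚ) := by push_cast; rfl
  rwa [hgq] at h

/-- **The cusp `u/(k g)` with `gcd(u, g) = 1`, `gcd(k g, N/g) = 1` lies in the class of `1/g`** (`g ∣ N`, `k ≥ 1`):
its reduced denominator `v` satisfies `g ∣ v ∣ k g`, hence `gcd(v, N) = g` and `gcd(v, N/g) = 1`
(`modularSymbol_sub_inv_gcd_mem_periodLattice`). [cite: Manin1972, Prop. 1.4 and Thm. 1.6]
[cite: CremonaAlgorithms1997, §2.2] -/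
theorem modularSymbol_div_mul_sub_inv_mem_periodLattice {g : ℕ} (hg : g ∣ N) (hgN : Nat.Coprime g (N / g))
    {u : ℤ} {k : ℕ} (hk : k ≠ 0) (hug : IsCoprime u (g : ℤ)) (hkN : Nat.Coprime k (N / g)) :
    modularSymbol f ((u : ℚ) / ((k : ℚ) * g)) - modularSymbol f (1 / (g : ℚ)) ∈ periodLattice f := by
  have hg0 : g ≠ 0 := fun h ↦ by
    rw [h, zero_dvd_iff] at hg
    exact (NeZero.ne N) hg
  set x : ℚ := (u : ℚ) / ((k : ℚ) * g) with hxdef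
  -- `den x ∣ k g`
  have hden_dvd : x.den ∣ k * g := by
    have h1 : x = Rat.divInt u ((k * g : ℕ) : ℤ) := by
      rw [hxdef, Rat.divInt_eq_div]; push_cast; ring
    have h2 := Rat.den_dvd u ((k * g : ℕ) : ℤ)
    rw [← h1] at h2
    exact_mod_cast h2
  -- `g ∣ den x` (from `x · den x = num x`, `gcd(u, g) = 1`)
  have hg_den : g ∣ x.den := by
    have hkg0 : ((k : ℚ) * g) ≠ 0 := by
      have : (k : ℚ) ≠ 0 := by exact_mod_cast hk
      have : (g : ℚ) ≠ 0 := by exact_mod_cast hg0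
      positivity
    have hxq : x * x.den = x.num := Rat.mul_den_eq_num x
    have heq : (x.num : ℚ) * ((k : ℚ) * g) = (u : ℚ) * x.den := by
      rw [← hxq, hxdef]
      field_simp
    have heqZ : x.num * ((k : ℤ) * g) = u * x.den := by exact_mod_cast heq
    have hdvd : (g : ℤ) ∣ u * x.den := ⟨x.num * k, by rw [← heqZ]; ring⟩
    exact Int.natCast_dvd_natCast.mp (hug.symm.dvd_of_dvd_mul_left hdvd)
  have hcopk : Nat.Coprime x.den (N / g) :=
    Nat.Coprime.coprime_dvd_left hden_dvd (Nat.Coprime.mul_left hkN hgN)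
  have hgcd : Nat.gcd x.den N = g := by
    conv_lhs => rw [← Nat.mul_div_cancel' hg]
    rw [Nat.Coprime.gcd_mul x.den hgN, Nat.gcd_eq_right hg_den,
      Nat.coprime_iff_gcd_eq_one.mp hcopk, mul_one]
  have h := modularSymbol_sub_inv_gcd_mem_periodLattice f (x := x) (by rwa [hgcd])
  rwa [hgcd] at h

/-- **The Eisenstein multiple at the cusp `1/g`: `(a_q − q − 1){∞, 1/g}_f ∈ Λ_f`** for a newform, `g ∣ N` with
`gcd(g, N/g) = 1`, and a prime `q ∤ N` (Manin's trick, Cremona 1997 (2.8.8), at the cusp `1/g` instead of `0`):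
in the Hecke relation `a_q{∞, 1/g} = ∑_{j mod q} {∞, (1/g + j)/q} + {∞, q/g}` (`cuspCoeff_mul_modularSymbol`) the
cusps `(1/g + j)/q = (1 + jg)/(qg)` and `q/g` all lie in the class of `1/g`
(`modularSymbol_div_mul_sub_inv_mem_periodLattice`: `gcd(1 + jg, g) = 1 = gcd(q, g)`, `gcd(q, N/g) = 1`).
No hypothesis on the residual representation: at `q = 2 ∤ N` this is `(a₂ − 3){∞, 1/g} ∈ Λ_f`.
[cite: CremonaAlgorithms1997, §2.8 (2.8.8)] [cite: MazurTateTeitelbaum1986Invent, §I.4 (4.2)] -/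
theorem sub_mul_modularSymbol_inv_mem_periodLattice {f : CuspForm (Gamma0 N) 2} (hf : IsNewform0 f) {g : ℕ}
    (hg : g ∣ N) (hgN : Nat.Coprime g (N / g)) {q : ℕ} (hq : q.Prime) (hqN : ¬ q ∣ N) :
    (cuspCoeff f q - q - 1) * modularSymbol f (1 / (g : ℚ)) ∈ periodLattice f := by
  haveI : NeZero q := ⟨hq.ne_zero⟩
  have hg0 : g ≠ 0 := fun h ↦ by
    rw [h, zero_dvd_iff] at hg
    exact (NeZero.ne N) hg
  have hH := cuspCoeff_mul_modularSymbol (p := q) hf hq hqN (1 / (g : ℚ))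
  have hqNg : Nat.Coprime q (N / g) :=
    (Nat.Prime.coprime_iff_not_dvd hq).mpr fun h ↦ hqN (h.trans (Nat.div_dvd_of_dvd hg))
  have hqg : IsCoprime (q : ℤ) (g : ℤ) := by
    rw [Nat.isCoprime_iff_coprime]
    exact (Nat.Prime.coprime_iff_not_dvd hq).mpr fun h ↦ hqN (h.trans hg)
  have hj : ∀ j : Fin q,
      modularSymbol f ((1 / (g : ℚ) + j) / q) - modularSymbol f (1 / (g : ℚ)) ∈ periodLattice f := by
    intro j
    have hug : IsCoprime (1 + (j : ℤ) * g) (g : ℤ) := isCoprime_one_left.add_mul_right_left _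
    have h := modularSymbol_div_mul_sub_inv_mem_periodLattice f hg hgN hq.ne_zero hug hqNg
    have heq : (((1 + (j : ℤ) * g : ℤ)) : ℚ) / ((q : ℚ) * g) = (1 / (g : ℚ) + j) / q := by
      have hg0' : (g : ℚ) ≠ 0 := by exact_mod_cast hg0
      have hq0' : (q : ℚ) ≠ 0 := by exact_mod_cast hq.ne_zero
      push_cast
      field_simp
    rwa [heq] at h
  have hlast : modularSymbol f ((q : ℚ) * (1 / (g : ℚ))) - modularSymbol f (1 / (g : ℚ)) ∈ periodLattice f := by
    have h := modularSymbol_div_mul_sub_inv_mem_periodLattice f hg hgN one_ne_zero hqg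
      (Nat.coprime_one_left _)
    have heq : ((q : ℤ) : ℚ) / (((1 : ℕ) : ℚ) * g) = (q : ℚ) * (1 / (g : ℚ)) := by
      push_cast
      ring
    rwa [heq] at h
  have hmem : ∑ j : Fin q, (modularSymbol f ((1 / (g : ℚ) + j) / q) - modularSymbol f (1 / (g : ℚ))) +
      (modularSymbol f ((q : ℚ) * (1 / (g : ℚ))) - modularSymbol f (1 / (g : ℚ))) ∈ periodLattice f :=
    add_mem (sum_mem fun j _ ↦ hj j) hlast
  have heq : ∑ j : Fin q, (modularSymbol f ((1 / (g : ℚ) + j) / q) - modularSymbol f (1 / (g : ℚ))) +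
      (modularSymbol f ((q : ℚ) * (1 / (g : ℚ))) - modularSymbol f (1 / (g : ℚ))) =
      (cuspCoeff f q - q - 1) * modularSymbol f (1 / (g : ℚ)) := by
    rw [Finset.sum_sub_distrib, Finset.sum_const, Finset.card_univ, Fintype.card_fin, nsmul_eq_mul]
    linear_combination -hH
  rwa [heq] at hmem

end CuspClass

/-! ### §2. `[x]⁺ − [1/g]⁺ ∈ ½ℤ` and `(a₂ − 3)[1/g]⁺ ∈ ½ℤ` (normalised symbols, real coefficients) -/

section Symbols

variable {N : ℕ} [NeZero N] (f : CuspForm (Gamma0 N) 2)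

/-- **`[x]⁺_f − [1/g]⁺_f ∈ ½ℤ`, `g = gcd(den x, N)`, at a cusp with `gcd(den x, N/g) = 1`** (real coefficients):
`{∞, x} − {∞, 1/g} ∈ Λ_f` (`modularSymbol_sub_inv_gcd_mem_periodLattice`), `re Λ_f = ℤ · Ω⁺_f/2`, and
`[x]⁺ = re{∞,x}/Ω⁺_f` (`plusSymbol_eq_re_holds`); junk case `Ω⁺_f = 0`: both symbols vanish. The class-`1/g`
companion of `exists_normalizedPlusSymbol_sub_zero_eq_div_two`. [cite: CremonaAlgorithms1997, §2.8]
[cite: Manin1972, Prop. 1.4 and Thm. 1.6] -/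
theorem exists_normalizedPlusSymbol_sub_inv_eq_div_two (hreal : ∀ n, (cuspCoeff f n).im = 0) {x : ℚ}
    (hx : Nat.Coprime x.den (N / Nat.gcd x.den N)) :
    ∃ k : ℤ, normalizedPlusSymbol f x - normalizedPlusSymbol f (1 / ((Nat.gcd x.den N : ℕ) : ℚ)) =
      (k : ℝ) / 2 := by
  by_cases hΩ : plusPeriod f = 0
  · refine ⟨0, ?_⟩
    rw [normalizedPlusSymbol_eq_zero_of_plusPeriod_eq_zero f hΩ,
      normalizedPlusSymbol_eq_zero_of_plusPeriod_eq_zero f hΩ]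
    simp
  obtain ⟨hre, hpos⟩ := realPeriods_eq_zmultiples_of_plusPeriod_ne_zero f hΩ
  obtain ⟨k, hk⟩ := exists_re_eq_add_of_sub_mem f hre (modularSymbol_sub_inv_gcd_mem_periodLattice f hx)
  refine ⟨k, ?_⟩
  rw [normalizedPlusSymbol, normalizedPlusSymbol, plusSymbol_eq_re_holds f hreal x,
    plusSymbol_eq_re_holds f hreal _, Complex.ofReal_re, Complex.ofReal_re, hk]
  field_simp
  ring

/-- **`(a₂ − 3)[1/g]⁺_f ∈ ½ℤ` for a newform of ODD level with real coefficients, `g ∣ N`, `gcd(g, N/g) = 1`**: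
the Eisenstein multiple `(a₂ − 2 − 1){∞, 1/g} ∈ Λ_f` at `2` (`sub_mul_modularSymbol_inv_mem_periodLattice`) read on
real parts (`re Λ_f = ℤ · Ω⁺_f/2`). No hypothesis on `E[2]`. The class-`1/g` companion of
`exists_sub_three_mul_normalizedPlusSymbol_zero_eq_div_two`. [cite: MazurTateTeitelbaum1986Invent, §I.4 (4.2)]
[cite: CremonaAlgorithms1997, §2.8 (2.8.8)] -/
theorem exists_sub_three_mul_normalizedPlusSymbol_inv_eq_div_two {f : CuspForm (Gamma0 N) 2}
    (hf : IsNewform0 f) (hreal : ∀ n, (cuspCoeff f n).im = 0) (h2N : ¬ 2 ∣ N) {a₂ : ℤ}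
    (ha₂ : cuspCoeff f 2 = a₂) {g : ℕ} (hg : g ∣ N) (hgN : Nat.Coprime g (N / g)) :
    ∃ k : ℤ, ((a₂ : ℝ) - 3) * normalizedPlusSymbol f (1 / (g : ℚ)) = (k : ℝ) / 2 := by
  by_cases hΩ : plusPeriod f = 0
  · refine ⟨0, ?_⟩
    rw [normalizedPlusSymbol_eq_zero_of_plusPeriod_eq_zero f hΩ]
    simp
  obtain ⟨hre, hpos⟩ := realPeriods_eq_zmultiples_of_plusPeriod_ne_zero f hΩ
  have hmem := sub_mul_modularSymbol_inv_mem_periodLattice hf hg hgN Nat.prime_two h2N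
  rw [ha₂] at hmem
  have hcast : ((a₂ : ℂ) - (2 : ℕ) - 1) = (((a₂ - 3 : ℤ) : ℝ) : ℂ) := by push_cast; ring
  rw [hcast] at hmem
  have hreal_part : ((((a₂ - 3 : ℤ) : ℝ) : ℂ) * modularSymbol f (1 / (g : ℚ))).re ∈ realPeriods f :=
    AddSubgroup.mem_map_of_mem _ hmem
  rw [hre, AddSubgroup.mem_zmultiples_iff] at hreal_part
  obtain ⟨k, hk⟩ := hreal_part
  refine ⟨k, ?_⟩
  rw [Complex.re_ofReal_mul, zsmul_eq_mul] at hk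
  rw [normalizedPlusSymbol, plusSymbol_eq_re_holds f hreal _, Complex.ofReal_re]
  push_cast at hk ⊢
  field_simp
  linarith

end Symbols

end Literature.NumberTheory.EllipticCurves.ModularForms

namespace Literature.NumberTheory.EllipticCurves

/-! ### §3. The rational plus symbols: `[x]⁺ = [1/g]⁺ + k/2` and `(a₂ − 3)[1/g]⁺ = k/2` in `ℚ` -/

section RatSymbols

variable {N : ℕ} [NeZero N] (f : CuspForm (Gamma0 N) 2)

/-- **`ratPlusSymbol f x = ratPlusSymbol f (1/g) + k/2`, `k ∈ ℤ`, `g = gcd(den x, N)`, at a cusp with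
`gcd(den x, N/g) = 1`** (real coefficients): `[x]⁺ − [1/g]⁺ ∈ ½ℤ` as real numbers
(`exists_normalizedPlusSymbol_sub_inv_eq_div_two`); junk-safe as `exists_ratPlusSymbol_eq_add_div_two` (if `[1/g]⁺ ∉ ℚ`
then `[x]⁺ ∉ ℚ` and both sides are `0`). [cite: MazurTateTeitelbaum1986Invent, §I.8] -/
theorem exists_ratPlusSymbol_eq_inv_add_div_two (hreal : ∀ n, (cuspCoeff f n).im = 0) {x : ℚ}
    (hx : Nat.Coprime x.den (N / Nat.gcd x.den N)) :
    ∃ k : ℤ, ratPlusSymbol f x = ratPlusSymbol f (1 / ((Nat.gcd x.den N : ℕ) : ℚ)) + (k : ℚ) / 2 := by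
  classical
  obtain ⟨k, hk⟩ := exists_normalizedPlusSymbol_sub_inv_eq_div_two f hreal hx
  set y : ℚ := 1 / ((Nat.gcd x.den N : ℕ) : ℚ) with hy
  by_cases h0 : ∃ q : ℚ, (q : ℝ) = normalizedPlusSymbol f y
  · have hx' : ∃ q : ℚ, (q : ℝ) = normalizedPlusSymbol f x := by
      obtain ⟨q, hq⟩ := h0
      exact ⟨q + (k : ℚ) / 2, by push_cast; rw [hq]; linarith⟩
    refine ⟨k, ?_⟩
    unfold ratPlusSymbol
    rw [dif_pos hx', dif_pos h0]
    apply Rat.cast_injective (α := ℝ)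
    push_cast
    rw [hx'.choose_spec, h0.choose_spec]
    linarith
  · have hx' : ¬ ∃ q : ℚ, (q : ℝ) = normalizedPlusSymbol f x := by
      rintro ⟨q, hq⟩
      exact h0 ⟨q - (k : ℚ) / 2, by push_cast; rw [hq]; linarith⟩
    refine ⟨0, ?_⟩
    unfold ratPlusSymbol
    rw [dif_neg hx', dif_neg h0]
    simp

/-- **`(a₂ − 3) · ratPlusSymbol f (1/g) = k/2`, `k ∈ ℤ`**, for a newform of odd level with real coefficients,
`g ∣ N`, `gcd(g, N/g) = 1` (`[1/g]⁺ ∉ ℚ` gives the junk `0 = 0/2`). [cite: MazurTateTeitelbaum1986Invent, §I.4 (4.2)] -/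
theorem exists_sub_three_mul_ratPlusSymbol_inv_eq_div_two {f : CuspForm (Gamma0 N) 2}
    (hf : IsNewform0 f) (hreal : ∀ n, (cuspCoeff f n).im = 0) (h2N : ¬ 2 ∣ N) {a₂ : ℤ}
    (ha₂ : cuspCoeff f 2 = a₂) {g : ℕ} (hg : g ∣ N) (hgN : Nat.Coprime g (N / g)) :
    ∃ k : ℤ, ((a₂ : ℚ) - 3) * ratPlusSymbol f (1 / (g : ℚ)) = (k : ℚ) / 2 := by
  classical
  by_cases h0 : ∃ q : ℚ, (q : ℝ) = normalizedPlusSymbol f (1 / (g : ℚ))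
  · obtain ⟨k, hk⟩ := exists_sub_three_mul_normalizedPlusSymbol_inv_eq_div_two hf hreal h2N ha₂ hg hgN
    refine ⟨k, ?_⟩
    unfold ratPlusSymbol
    rw [dif_pos h0]
    apply Rat.cast_injective (α := ℝ)
    push_cast
    rw [h0.choose_spec, hk]
  · refine ⟨0, ?_⟩
    unfold ratPlusSymbol
    rw [dif_neg h0]
    simp

end RatSymbols

/-! ### §4. `2`-adic norms: `‖(α − 1)[1/g]⁺‖₂ ≤ 2` and `‖μ_{f,α,m}‖₂ ≤ 2` at a tame level meeting `N` -/

section Measure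

variable {N : ℕ} [NeZero N] (f : CuspForm (Gamma0 N) 2) {m : ℕ}

/-- `‖2‖₂ = 1/2`; private helper. [folklore] -/
private theorem norm_two_two' : ‖(2 : ℚ_[2])‖ = (2 : ℝ)⁻¹ := by
  have h := Padic.norm_p (p := 2)
  simpa using h

/-- `‖k/2‖₂ ≤ 2` for `k ∈ ℤ`; private helper. [folklore] -/
private theorem norm_intCast_div_two_le' (k : ℤ) : ‖((k : ℚ_[2])) / 2‖ ≤ 2 := by
  rw [norm_div, norm_two_two', div_inv_eq_mul]
  calc ‖(k : ℚ_[2])‖ * 2 ≤ 1 * 2 := by gcongr; exact Padic.norm_int_le_one k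
    _ = 2 := one_mul _

/-- `‖α‖₂ = 1` and `‖α − 2‖₂ = 1` for a root `α` of `X² − a₂X + 2` with `‖α⁻¹‖₂ ≤ 1`; private helper
(the computation inside `norm_sub_one_mul_ratPlusSymbol_zero_le_two`). [cite: MazurTateTeitelbaum1986Invent, §I.11 (allowable root)] -/
private theorem norm_eq_one_and_norm_sub_two {a₂ : ℤ} {α : ℚ_[2]} (hα : ‖α⁻¹‖ ≤ 1)
    (hroot : α ^ 2 - a₂ * α + 2 = 0) : ‖α‖ = 1 ∧ ‖α - 2‖ = 1 := by
  have hα0 : α ≠ 0 := by rintro rfl; norm_num at hroot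
  have hαle : ‖α‖ ≤ 1 := by
    have h1 : α = (a₂ : ℚ_[2]) - 2 * α⁻¹ := by
      field_simp
      linear_combination hroot
    rw [h1, sub_eq_add_neg]
    refine (Padic.nonarchimedean _ _).trans (max_le (Padic.norm_int_le_one _) ?_)
    rw [norm_neg, norm_mul, norm_two_two']
    calc (2 : ℝ)⁻¹ * ‖α⁻¹‖ ≤ 2⁻¹ * 1 := by gcongr
      _ ≤ 1 := by norm_num
  have hαge : 1 ≤ ‖α‖ := by
    have h := norm_mul α α⁻¹
    rw [mul_inv_cancel₀ hα0, norm_one] at h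
    nlinarith [norm_nonneg α, norm_nonneg α⁻¹]
  have hαu : ‖α‖ = 1 := le_antisymm hαle hαge
  refine ⟨hαu, le_antisymm ?_ ?_⟩
  · rw [sub_eq_add_neg]
    refine (Padic.nonarchimedean _ _).trans (max_le hαle ?_)
    rw [norm_neg, norm_two_two']; norm_num
  · have h : ‖α‖ ≤ max ‖α - 2‖ ‖(2 : ℚ_[2])‖ := by
      have := Padic.nonarchimedean (α - 2) 2
      rwa [sub_add_cancel] at this
    rw [hαu, norm_two_two'] at h
    rcases le_max_iff.mp h with h | h
    · exact h
    · norm_num at h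

/-- **`‖(α − 1)·[1/g]⁺_f‖₂ ≤ 2`** for a newform of odd level with real coefficients, `g ∣ N` with
`gcd(g, N/g) = 1`, and a root `α` of `X² − a₂X + 2` with `‖α⁻¹‖₂ ≤ 1`: `(α − 1)(α − 2) = (a₂ − 3)α`,
`‖α‖₂ = 1 = ‖α − 2‖₂`, and `‖(a₂ − 3)[1/g]⁺‖₂ = ‖k/2‖₂ ≤ 2` (`exists_sub_three_mul_ratPlusSymbol_inv_eq_div_two`).
The class-`1/g` companion of `norm_sub_one_mul_ratPlusSymbol_zero_le_two`. [cite: MazurTateTeitelbaum1986Invent, §I.10 (10.1)] -/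
theorem norm_sub_one_mul_ratPlusSymbol_inv_le_two {f : CuspForm (Gamma0 N) 2} (hf : IsNewform0 f)
    (hreal : ∀ n, (cuspCoeff f n).im = 0) (h2N : ¬ 2 ∣ N) {a₂ : ℤ} (ha₂ : cuspCoeff f 2 = a₂)
    {α : ℚ_[2]} (hα : ‖α⁻¹‖ ≤ 1) (hroot : α ^ 2 - a₂ * α + 2 = 0) {g : ℕ} (hg : g ∣ N)
    (hgN : Nat.Coprime g (N / g)) :
    ‖(α - 1) * ((ratPlusSymbol f (1 / (g : ℚ)) : ℚ) : ℚ_[2])‖ ≤ 2 := by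
  obtain ⟨k, hk⟩ := exists_sub_three_mul_ratPlusSymbol_inv_eq_div_two hf hreal h2N ha₂ hg hgN
  obtain ⟨hαu, hα2⟩ := norm_eq_one_and_norm_sub_two hα hroot
  set q : ℚ_[2] := ((ratPlusSymbol f (1 / (g : ℚ)) : ℚ) : ℚ_[2]) with hq
  have hkey : (α - 1) * q * (α - 2) = (((a₂ : ℚ) - 3) * ratPlusSymbol f (1 / (g : ℚ)) : ℚ) * α := by
    push_cast
    rw [← hq]
    linear_combination q * hroot
  have hk2 : ‖((((a₂ : ℚ) - 3) * ratPlusSymbol f (1 / (g : ℚ)) : ℚ) : ℚ_[2])‖ ≤ 2 := by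
    rw [hk]
    push_cast
    exact norm_intCast_div_two_le' k
  have h := congrArg (‖·‖) hkey
  simp only [norm_mul, hα2, hαu, mul_one] at h
  rw [norm_mul, h]
  exact hk2

omit [NeZero N] in
/-- `gcd(den(2x), N) = gcd(den x, N)` for odd `N` (`den(2x) ∣ den x ∣ 2 den(2x)`); private helper. [folklore] -/
private theorem gcd_den_two_mul_eq (h2N : ¬ 2 ∣ N) (x : ℚ) : Nat.gcd ((2 : ℚ) * x).den N = Nat.gcd x.den N := by
  have h1 : ((2 : ℚ) * x).den ∣ x.den := by
    have h := Rat.mul_den_dvd (2 : ℚ) x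
    simpa using h
  have h2 : x.den ∣ 2 * ((2 : ℚ) * x).den := by
    have h := Rat.mul_den_dvd ((2 : ℚ)⁻¹) ((2 : ℚ) * x)
    have hx : (2 : ℚ)⁻¹ * ((2 : ℚ) * x) = x := by ring
    rw [hx] at h
    have hd : ((2 : ℚ)⁻¹).den = 2 := by norm_num
    rwa [hd] at h
  refine Nat.dvd_antisymm (Nat.gcd_dvd_gcd_of_dvd_left N h1) ?_
  have hcop : Nat.Coprime 2 N := (Nat.Prime.coprime_iff_not_dvd Nat.prime_two).mpr h2N
  have h3 : Nat.gcd x.den N ∣ Nat.gcd (2 * ((2 : ℚ) * x).den) N := Nat.gcd_dvd_gcd_of_dvd_left N h2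
  rwa [Nat.Coprime.gcd_mul_left_cancel _ hcop] at h3

omit [NeZero N] in
/-- For `d ∣ 2ⁿ·m` with `N` odd and `N` square-free at the primes of `m`: `gcd(d, N/gcd(d, N)) = 1`
(a prime `ℓ` dividing `d` and `N/g` divides `g` and `N/g`, so `ℓ² ∣ N`, while `ℓ ∣ m`); private helper. [folklore] -/
private theorem coprime_div_gcd_of_dvd (h2N : ¬ 2 ∣ N) (hmN : ∀ ℓ : ℕ, ℓ.Prime → ℓ ∣ m → ¬ ℓ ^ 2 ∣ N)
    {n d : ℕ} (hd : d ∣ 2 ^ n * m) : Nat.Coprime d (N / Nat.gcd d N) := by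
  set g := Nat.gcd d N with hgdef
  have hg : g ∣ N := Nat.gcd_dvd_right _ _
  refine Nat.coprime_of_dvd fun ℓ hℓ hℓd hℓNg ↦ ?_
  have hℓN : ℓ ∣ N := hℓNg.trans (Nat.div_dvd_of_dvd hg)
  have hℓg : ℓ ∣ g := Nat.dvd_gcd hℓd hℓN
  have hℓ2N : ℓ ^ 2 ∣ N := by
    rw [sq, ← Nat.mul_div_cancel' hg]
    exact Nat.mul_dvd_mul hℓg hℓNg
  have hℓm : ℓ ∣ m := by
    rcases (Nat.Prime.dvd_mul hℓ).mp (hℓd.trans hd) with h | h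
    · have hℓ2 : ℓ = 2 := (Nat.prime_dvd_prime_iff_eq hℓ Nat.prime_two).mp (hℓ.dvd_of_dvd_pow h)
      exact absurd (hℓ2 ▸ hℓN) h2N
    · exact h
  exact hmN ℓ hℓ hℓm hℓ2N

/-- The denominator of `c/(2ⁿm)` divides `2ⁿm`; private helper. [folklore] -/
private theorem den_natCast_div_dvd (c n : ℕ) (m : ℕ) : ((c : ℚ) / ((2 : ℚ) ^ n * m)).den ∣ 2 ^ n * m := by
  have h1 : (c : ℚ) / ((2 : ℚ) ^ n * m) = Rat.divInt c ((2 ^ n * m : ℕ) : ℤ) := by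
    rw [Rat.divInt_eq_div]; push_cast; ring
  have h2 := Rat.den_dvd (c : ℤ) ((2 ^ n * m : ℕ) : ℤ)
  rw [← h1] at h2
  exact_mod_cast h2

/-- **`‖μ_{f,α,m}((a + 2ⁿℤ₂) × {b})‖₂ ≤ 2` for every newform of ODD level `N` with real coefficients, a tame level `m`
with `N` SQUARE-FREE AT THE PRIMES OF `m`, and the root `α` of `X² − a₂X + 2` with `‖α⁻¹‖ ≤ 1` — NO hypothesis
on `E[2]`**: the tame fractions `x = c/(2ⁿm)` and `2x` have `gcd(den, N) = g` (the same `g`) with `gcd(den, N/g) = 1`,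
so `[x]⁺ = [1/g]⁺ + k₁/2`, `[2x]⁺ = [1/g]⁺ + k₂/2` (`exists_ratPlusSymbol_eq_inv_add_div_two`) and
`μ = α⁻ⁿk₁/2 − α⁻ⁿ⁻¹k₂/2 + α⁻ⁿ⁻¹(α − 1)[1/g]⁺`, three terms of norm `≤ 2` (`norm_sub_one_mul_ratPlusSymbol_inv_le_two`).
The tree's `norm_msdMeasureTame_two_le_two_auto` with `(m, N) = 1` relaxed to `hmN`.
[cite: MazurTateTeitelbaum1986Invent, §I.10 (10.1) and §I.4 (4.2)] [cite: CremonaAlgorithms1997, §2.2 and §2.8] -/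
theorem norm_msdMeasureTame_two_le_two_sqfreeAt {f : CuspForm (Gamma0 N) 2} (hf : IsNewform0 f)
    (hreal : ∀ n, (cuspCoeff f n).im = 0) (h2N : ¬ 2 ∣ N) {a₂ : ℤ} (ha₂ : cuspCoeff f 2 = a₂) {α : ℚ_[2]}
    (hα : ‖α⁻¹‖ ≤ 1) (hroot : α ^ 2 - a₂ * α + 2 = 0) (hmN : ∀ ℓ : ℕ, ℓ.Prime → ℓ ∣ m → ¬ ℓ ^ 2 ∣ N)
    (n : ℕ) (a : ZMod (2 ^ n)) (b : ZMod m) :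
    ‖msdMeasureTame f m α n a b‖ ≤ 2 := by
  have hαi : ∀ j : ℕ, ‖α⁻¹ ^ j‖ ≤ 1 := fun j ↦ by
    rw [norm_pow]; exact pow_le_one₀ (norm_nonneg _) hα
  have hα0 : α ≠ 0 := by rintro rfl; norm_num at hroot
  set x : ℚ := tameFraction 2 m n a b with hxdef
  set g : ℕ := Nat.gcd x.den N with hgdef
  have hg : g ∣ N := Nat.gcd_dvd_right _ _
  -- the two tame fractions `x`, `2x` and their common class `1/g`
  have hxd : x.den ∣ 2 ^ n * m := by
    rw [hxdef, tameFraction]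
    have h := den_natCast_div_dvd (tameRep 2 m n a b) n m
    push_cast at h ⊢
    exact h
  have hx : Nat.Coprime x.den (N / g) := coprime_div_gcd_of_dvd h2N hmN hxd
  have h2xg : Nat.gcd ((2 : ℚ) * x).den N = g := gcd_den_two_mul_eq h2N x
  have h2xd : ((2 : ℚ) * x).den ∣ 2 ^ n * m := by
    have h := Rat.mul_den_dvd (2 : ℚ) x
    have h' : ((2 : ℚ) * x).den ∣ x.den := by simpa using h
    exact h'.trans hxd
  have h2x : Nat.Coprime ((2 : ℚ) * x).den (N / Nat.gcd ((2 : ℚ) * x).den N) :=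
    coprime_div_gcd_of_dvd h2N hmN h2xd
  have hgN : Nat.Coprime g (N / g) := Nat.Coprime.coprime_dvd_left (Nat.gcd_dvd_left _ _) hx
  have hε := norm_sub_one_mul_ratPlusSymbol_inv_le_two hf hreal h2N ha₂ hα hroot hg hgN
  obtain ⟨z₁, hz₁⟩ := exists_ratPlusSymbol_eq_inv_add_div_two f hreal (x := x) hx
  obtain ⟨z₂, hz₂⟩ := exists_ratPlusSymbol_eq_inv_add_div_two f hreal (x := (2 : ℚ) * x) h2x
  rw [h2xg] at hz₂
  have hcast : ((2 : ℕ) : ℚ) = (2 : ℚ) := by norm_num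
  unfold msdMeasureTame
  rw [← hxdef, hcast, hz₁, hz₂]
  push_cast
  set r : ℚ_[2] := ((ratPlusSymbol f (1 / (g : ℚ)) : ℚ) : ℚ_[2]) with hr
  have hsplit : α⁻¹ ^ n * (r + (z₁ : ℚ_[2]) / 2) - α⁻¹ ^ (n + 1) * (r + (z₂ : ℚ_[2]) / 2) =
      α⁻¹ ^ n * ((z₁ : ℚ_[2]) / 2) + -(α⁻¹ ^ (n + 1) * ((z₂ : ℚ_[2]) / 2)) +
        α⁻¹ ^ (n + 1) * ((α - 1) * r) := by
    have hαα : α⁻¹ ^ (n + 1) * α = α⁻¹ ^ n := by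
      rw [pow_succ, mul_assoc, inv_mul_cancel₀ hα0, mul_one]
    linear_combination (-r) * hαα
  rw [hsplit]
  have hA : ‖α⁻¹ ^ n * ((z₁ : ℚ_[2]) / 2)‖ ≤ 2 := by
    rw [norm_mul]
    calc _ ≤ 1 * 2 := mul_le_mul (hαi _) (norm_intCast_div_two_le' z₁) (norm_nonneg _) zero_le_one
      _ = 2 := one_mul _
  have hB : ‖-(α⁻¹ ^ (n + 1) * ((z₂ : ℚ_[2]) / 2))‖ ≤ 2 := by
    rw [norm_neg, norm_mul]
    calc _ ≤ 1 * 2 := mul_le_mul (hαi _) (norm_intCast_div_two_le' z₂) (norm_nonneg _) zero_le_one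
      _ = 2 := one_mul _
  have hC : ‖α⁻¹ ^ (n + 1) * ((α - 1) * r)‖ ≤ 2 := by
    rw [norm_mul]
    calc _ ≤ 1 * 2 := mul_le_mul (hαi _) hε (norm_nonneg _) zero_le_one
      _ = 2 := one_mul _
  refine (Padic.nonarchimedean _ _).trans (max_le ?_ hC)
  exact (Padic.nonarchimedean _ _).trans (max_le hA hB)

variable {W : WeierstrassCurve ℚ} [W.IsElliptic] [W.IsGloballyMinimal]

/-- **`‖μ_{f,α,m}((a + 2ⁿℤ₂) × {b})‖₂ ≤ 2` for the newform `f` (level `N`) of ANY `E = W` good ordinary at `2`**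
(`α` the unit root) at a tame level `m` such that `N` is square-free at the primes of `m` — the tree's
`norm_msdMeasureTame_unitRoot_two_le_two_auto` with `(m, N) = 1` relaxed. [cite: MazurTateTeitelbaum1986Invent, §I.10 (10.1)] -/
theorem norm_msdMeasureTame_unitRoot_two_le_two_sqfreeAt {f : CuspForm (Gamma0 N) 2} (hord : IsOrdinaryAt W 2)
    (hf : IsNewformOf W f) (hmN : ∀ ℓ : ℕ, ℓ.Prime → ℓ ∣ m → ¬ ℓ ^ 2 ∣ N) (n : ℕ) (a : ZMod (2 ^ n))
    (b : ZMod m) : ‖msdMeasureTame f m (unitRoot W 2 : ℚ_[2]) n a b‖ ≤ 2 := by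
  obtain ⟨hαeq, hαu, -⟩ := unitRoot_coe_spec (W := W) hord
  have hα : ‖(unitRoot W 2 : ℚ_[2])⁻¹‖ ≤ 1 := by rw [norm_inv, hαu, inv_one]
  exact norm_msdMeasureTame_two_le_two_sqfreeAt hf.1 (cuspCoeff_im_eq_zero_of_coeffField_eq_bot hf.coeffField_eq_bot)
    (not_dvd_level_of_isNewformOf hf hord.1) (cuspCoeff_eq_frobeniusTrace_of_isNewformOf_holds hf hord.1) hα hαeq
    hmN n a b

end Measure

/-! ### §5. Integrality of `L₂(f,α,χ)` and Matsuno's Lemma 3.2 at `2` at a tame level meeting `N` -/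

section Integrality

variable {N : ℕ} [NeZero N] {f : CuspForm (Gamma0 N) 2} {m : ℕ} [NeZero m]
  {W : WeierstrassCurve ℚ} [W.IsElliptic] [W.IsGloballyMinimal]

omit [NeZero m] in
/-- The trivial character mod `m` is even; private helper. [folklore] -/
private theorem even_one_dirichletCharacter'' {R : Type*} [CommRing R] : (1 : DirichletCharacter R m).Even := by
  show (1 : DirichletCharacter R m) (-1) = 1
  rw [MulChar.one_apply (isUnit_one.neg)]

/-- **`‖[T^k] L₂(f, α, χ, T)‖₂ ≤ 1` for `χ` EVEN, EVERY `E` good ordinary at `2`, and a tame level `m` (odd) at whose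
primes `N` is square-free** — the tree's `norm_padicLCoeffTame_two_le_one_auto` with `(m, N) = 1` relaxed (`‖μ‖ ≤ 2`
from §4, the doubling `norm_padicLRiemannSumTame_two_le`, convergence `tendsto_padicLRiemannSumTame_unitRoot_two`).
[cite: MazurTateTeitelbaum1986Invent, §I.10–§I.13 (pp. 12–19)] -/
theorem norm_padicLCoeffTame_two_le_one_sqfreeAt (hord : IsOrdinaryAt W 2) (hf : IsNewformOf W f)
    (hm2 : m.Coprime 2) (hmN : ∀ ℓ : ℕ, ℓ.Prime → ℓ ∣ m → ¬ ℓ ^ 2 ∣ N) (χ : DirichletCharacter ℚ_[2] m)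
    (hχ : χ.Even) (k : ℕ) : ‖padicLCoeffTame f m (unitRoot W 2 : ℚ_[2]) χ k‖ ≤ 1 := by
  have hμ := norm_msdMeasureTame_unitRoot_two_le_two_sqfreeAt (m := m) hord hf hmN
  have h2 : ‖(2 : ℚ_[2])‖ = (2 : ℝ)⁻¹ := by
    have h := Padic.norm_p (p := 2)
    simpa using h
  have hRS : ∀ n, ‖padicLRiemannSumTame f m (unitRoot W 2 : ℚ_[2]) χ k n‖ ≤ 1 := by
    intro n
    have h := norm_padicLRiemannSumTame_two_le f hm2 _ χ hχ zero_le_two hμ k n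
    rw [h2] at h
    linarith
  exact le_of_tendsto (tendsto_padicLRiemannSumTame_unitRoot_two hord hf hm2 χ k).norm (Eventually.of_forall hRS)

/-- **`L₂(f, α, χ, T) ∈ Λ = ℤ₂⟦T⟧` for `χ` even, EVERY `E` good ordinary at `2`, and a tame level `m` (odd) at whose
primes `N` is square-free.** [cite: MazurTateTeitelbaum1986Invent, §I.12 (p. 17)] -/
theorem exists_iwasawaToPowerSeries_eq_padicLFunctionTame_two_sqfreeAt (hord : IsOrdinaryAt W 2)
    (hf : IsNewformOf W f) (hm2 : m.Coprime 2) (hmN : ∀ ℓ : ℕ, ℓ.Prime → ℓ ∣ m → ¬ ℓ ^ 2 ∣ N)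
    (χ : DirichletCharacter ℚ_[2] m) (hχ : χ.Even) :
    ∃ G : IwasawaAlgebra 2, iwasawaToPowerSeries 2 G = padicLFunctionTame f m (unitRoot W 2 : ℚ_[2]) χ :=
  (exists_iwasawaToPowerSeries_eq_iff_norm_coeff_le_one _).mpr fun k ↦ by
    rw [coeff_padicLFunctionTame]
    exact norm_padicLCoeffTame_two_le_one_sqfreeAt hord hf hm2 hmN χ hχ k

/-- **Matsuno 2000, Lemma 3.2 at `p = 2` for EVERY `E` good ordinary at `2` at a tame level meeting `N`** (tree
normalisation): for `χ` even with `χ² = 1` mod `m`, `m` odd, `N` square-free at the primes of `m`: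
`‖[T^k] L₂(f,α,χ) − [T^k] L₂(f,α,𝟙_m)‖₂ ≤ ‖2‖₂`. [cite: Matsuno2000, Lemma 3.2 (p. 87)] -/
theorem norm_padicLCoeffTame_sub_one_two_le_sqfreeAt (hord : IsOrdinaryAt W 2) (hf : IsNewformOf W f)
    (hm2 : m.Coprime 2) (hmN : ∀ ℓ : ℕ, ℓ.Prime → ℓ ∣ m → ¬ ℓ ^ 2 ∣ N) (χ : DirichletCharacter ℚ_[2] m)
    (hχ : χ.Even) (hsq : χ ^ 2 = 1) (k : ℕ) :
    ‖padicLCoeffTame f m (unitRoot W 2 : ℚ_[2]) χ k -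
        padicLCoeffTame f m (unitRoot W 2 : ℚ_[2]) (1 : DirichletCharacter ℚ_[2] m) k‖ ≤ ‖(2 : ℚ_[2])‖ := by
  have hμ := norm_msdMeasureTame_unitRoot_two_le_two_sqfreeAt (m := m) hord hf hmN
  have h2 : ‖(2 : ℚ_[2])‖ = (2 : ℝ)⁻¹ := by
    have h := Padic.norm_p (p := 2)
    simpa using h
  have hRS : ∀ n, ‖padicLRiemannSumTame f m (unitRoot W 2 : ℚ_[2]) χ k n -
      padicLRiemannSumTame f m (unitRoot W 2 : ℚ_[2]) (1 : DirichletCharacter ℚ_[2] m) k n‖ ≤ ‖(2 : ℚ_[2])‖ := by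
    intro n
    have h := norm_padicLRiemannSumTame_sub_two_le f hm2 _ χ 1 hχ even_one_dirichletCharacter'' (norm_nonneg _)
      (norm_sub_one_apply_le_of_sq_eq_one χ hsq) zero_le_two hμ k n
    rw [h2] at h ⊢
    linarith
  exact le_of_tendsto ((tendsto_padicLRiemannSumTame_unitRoot_two hord hf hm2 χ k).sub
    (tendsto_padicLRiemannSumTame_unitRoot_two hord hf hm2 1 k)).norm (Eventually.of_forall hRS)

/-- **`L₂(f,α,χ) ≡ L₂(f,α,𝟙_m) (mod 2Λ)` as reductions of integral lifts, for EVERY `E` good ordinary at `2` at a tame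
level meeting `N`** (χ even quadratic, `m` odd, `N` square-free at the primes of `m`) — the tree's
`exists_iwasawa_pair_map_toZMod_eq_two_auto` with `(m, N) = 1` relaxed. [cite: Matsuno2000, Lemma 3.2 (p. 87)]
[cite: MazurTateTeitelbaum1986Invent, §I.12 (p. 17)] -/
theorem exists_iwasawa_pair_map_toZMod_eq_two_sqfreeAt (hord : IsOrdinaryAt W 2) (hf : IsNewformOf W f)
    (hm2 : m.Coprime 2) (hmN : ∀ ℓ : ℕ, ℓ.Prime → ℓ ∣ m → ¬ ℓ ^ 2 ∣ N) (χ : DirichletCharacter ℚ_[2] m)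
    (hχ : χ.Even) (hsq : χ ^ 2 = 1) :
    ∃ G G₁ : IwasawaAlgebra 2,
      iwasawaToPowerSeries 2 G = padicLFunctionTame f m (unitRoot W 2 : ℚ_[2]) χ ∧
      iwasawaToPowerSeries 2 G₁ = padicLFunctionTame f m (unitRoot W 2 : ℚ_[2]) (1 : DirichletCharacter ℚ_[2] m) ∧
      PowerSeries.map (PadicInt.toZMod (p := 2)) G = PowerSeries.map (PadicInt.toZMod (p := 2)) G₁ := by
  refine exists_iwasawa_pair_map_toZMod_eq _ _ (fun k ↦ ?_) (fun k ↦ ?_) (fun k ↦ ?_)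
  · rw [coeff_padicLFunctionTame]
    exact norm_padicLCoeffTame_two_le_one_sqfreeAt hord hf hm2 hmN χ hχ k
  · rw [coeff_padicLFunctionTame]
    exact norm_padicLCoeffTame_two_le_one_sqfreeAt hord hf hm2 hmN 1 even_one_dirichletCharacter'' k
  · rw [coeff_padicLFunctionTame, coeff_padicLFunctionTame]
    have h2 : ‖(2 : ℚ_[2])‖ = (2 : ℝ)⁻¹ := by
      have h := Padic.norm_p (p := 2)
      simpa using h
    have h := norm_padicLCoeffTame_sub_one_two_le_sqfreeAt hord hf hm2 hmN χ hχ hsq k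
    rw [h2] at h
    linarith

end Integrality

end Literature.NumberTheory.EllipticCurves

end
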